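import Literature.AnabelianGeometry.EtaleTheta.Discharge.Sec3EffRealSpanTateTowerKummer
import Literature.AnabelianGeometry.EtaleTheta.Discharge.Sec3Cor38KummerTwistTower
import HarnessLib

/-!
# [EtTh] Prop. 3.4 (ii), the `Λ = ℝ` effective-locus clause `hE`, PROVED at the ζ-TWISTED Kummer–Tate tower
# (`TateTowerKummerTwist.towerC`, Def. 3.3 (iii) v2 with covering-indexed `Mero`, `DivisorMonoids.ofTower`)

S. Mochizuki, *The étale theta function and its Frobenioid-theoretic manifestations*, Publ. RIMS **45** (2009), Prop. 3.4 (ii)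
p.74 read at the monoid type `Λ = ℝ` of Def. 3.6 (i) p.76 (`B₀^ℝ := ℝ·Φ₀^birat`, `F₀^ℝ := ℝ·Φ₀^cnst`); Def. 3.3 (iii) pp.73–74
[cite: MochizukiEtTh2009, Prop 3.4 (ii) p.74]; the `ℝ`-vector spaces `(Φ₀(Y)^rlf)^gp`: [FrdI] Def. 2.4 (i) p.48 / Prop. 5.3 p.103
[cite: MochizukiFrdI2008, Def. 2.4(i) p.48].

PROOF-ONLY (theorems only; abc-iut cell, layer L2, seat abc-iut-w6-d057 gen 4; abc-iut-L2-lead row R914/R936 «PROP34CNST₀ WITH NON-CONSTANT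
`D^cnst` AT THE TWISTED TOWER», input (F2) of its `Λ = ℝ` sequel).  The twin, at abc-iut-L2-d2's ζ-twisted tower `towerC` (p478618;
levels `TateTowerTwist.model (MuN n)` with functions `μ_{Nₙ} × ⟨ϖₙ⟩ × ⟨Uₙ⟩`, `Compat` acting through `rho n`), of abc-iut-L2-d2's
`TateTowerKummer.effRealSpan_ofTower` (p465055, `Sec3EffRealSpanTateTowerKummer.lean`) — whose §B is followed step by step; consumed BY
NAME: its generic `RlfDegreeWeak.*` / `RealificationDataLemmas.*` toolkit (abc-iut-L2-d2 gen 5), abc-iut-L2-d2 gen 6's twisted-level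
lemmas `divZero_eq_zpow_of_forall_snd_eq` / `unif_mem_bZero_actionOf` / `constDIV_one_mem_phiZero_actionOf` / `snd_actFn_actionOf`
(`Sec3Cor38KummerTwistTower.lean`, p482744), `hpfC` (p481604), abc-iut-w6-d048/w6-d052's skeleton lemmas.
* §A the twisted levels `model A` under ANY action `actionOf A ρ`: divisors read at a component see only the skeleton part
  (`val_divAt_inr_actionOf`), «`U`-exponent `0` at one point ⇒ the skeleton part is constant along a transitive set»
  (`snd_apply_eq_of_snd_apply_eq`), and the power relation **at the level of `div₀`** — `div₀(b)^{k₀} = [Σ_j F_j]^{c k₀ − c₀ k} · div₀(b₀)^k`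
  (`divZero_zpow_eq_actionOf`): the `B₀`-level identity `b^{k₀} = ϖ^{…}·b₀^{k}` of the untwisted file is FALSE here on the nose (the
  roots of unity of `b`, `b₀` do not cancel), but `div₀` does not see the μ-coordinate.
* §B at `(ofTower towerC, Y)`: the multiplicity-at-`F_j` degrees `Φ₀(Y)^rlf → ℝ_{≥0}`, their value `c + k·j` on `ι(div₀ b)`, the NORMAL
  FORM of `ℝ·Φ₀^birat(Y)`, and **`effRealSpan_ofTowerC`** (`hE` at the twisted tower, every connected tempered covering): effectivity forces
  `a + β(c₀ + k₀ j) ≥ 0` for all `j ∈ ℤ`, so the `U`-part vanishes.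
HONEST LABEL: elementary verification at CONSTRUCTED class-(b) data; refereed pre-IUT material; nothing here bears on [IUTchIII] Cor. 3.12; no
side taken; typed ≠ proved — here proved.
-/

noncomputable section

namespace Literature.AnabelianGeometry.EtaleTheta

open CategoryTheory Opposite Function NNReal Literature.AlgebraicGeometry.Frobenioids Literature.AnabelianGeometry.SemiGraphs
  Literature.AlgebraicGeometry.Frobenioids.QuasiTemperoid LogDivisorModel LogDivisorModel.GaloisAction LogDivisorModel.TateTower
  LogDivisorTower

/-! ## §A The twisted levels under an arbitrary action `actionOf A ρ` -/

namespace LogDivisorModel.TateTowerTwist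

open TateTowerFrd

variable {A : Type} [CommGroup A] [Finite A] {P : Type} [Group P] (ρ : P →* Twist A) (S : Action (Type 0) P)

/-- The divisor of `b ∈ B₀(S)` at `s`, read at the component `F_j`: `c + k·j` for `b(s) = (ζ, ϖ^c U^k)` — the μ-coordinate is
invisible. [cite: MochizukiEtTh2009, Def 3.1 p.70] -/
theorem val_divAt_inr_actionOf (b : (actionOf A ρ).bZero S) (s : S.V) (j : ℤ) :
    val ((actionOf A ρ).divAt S b s) (Sum.inr j) = (Multiplicative.toAdd (b.1 s).2).1 + (Multiplicative.toAdd (b.1 s).2).2 * j := by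
  change Multiplicative.toAdd (divHom (b.1 s).2) (Sum.inr j) = _
  rw [toAdd_divHom]
  rfl

/-- `div₀ b = [N]/[D]` read at `F_j`: `(c + k·j) + mult_{F_j} D(s) = mult_{F_j} N(s)`. [cite: MochizukiEtTh2009, Def 3.3 p.73] -/
theorem val_divNum_inr_actionOf (b : (actionOf A ρ).bZero S) (s : S.V) (j : ℤ) :
    (Multiplicative.toAdd (b.1 s).2).1 + (Multiplicative.toAdd (b.1 s).2).2 * j + val (((actionOf A ρ).divDen S b).1 s) (Sum.inr j) =
      val (((actionOf A ρ).divNum S b).1 s) (Sum.inr j) := by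
  rw [← val_divAt_inr_actionOf, ← (actionOf A ρ).divAt_mul_divDen]
  rfl

/-- On a TRANSITIVE `P`-set, an equivariant function whose skeleton part at `s₀` is a constant `ϖ^c` has that skeleton part
everywhere (the shear fixes `(c, 0)`; the μ-coordinate may move). [cite: MochizukiEtTh2009, Def 3.3 p.73] -/
theorem snd_apply_eq_of_snd_apply_eq (htrans : ∀ s u : S.V, ∃ g : P, S.ρ g s = u) (s₀ : S.V) (b : (actionOf A ρ).bZero S) {c : ℤ}
    (hc : (b.1 s₀).2 = Multiplicative.ofAdd ((c, 0) : ℤ × ℤ)) (s : S.V) : (b.1 s).2 = Multiplicative.ofAdd ((c, 0) : ℤ × ℤ) := by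
  obtain ⟨g, rfl⟩ := htrans s₀ s
  rw [b.2.2 g s₀, snd_actFn_actionOf, hc, shearFn_const]

/-- **The power relation at the level of `div₀`** on a transitive `P`-set: for `b₀(s₀) = (·, ϖ^{c₀} U^{k₀})`, `b(s₀) = (·, ϖ^c U^k)`,
`div₀(b)^{k₀} = [d]^{c k₀ − c₀ k} · div₀(b₀)^{k}` for any `d ∈ Φ₀(S)` with constant value `Σ_j [F_j]` (the function
`b^{k₀} · b₀^{−k}` has skeleton part `ϖ^{c k₀ − c₀ k}` at `s₀`, hence everywhere). [cite: MochizukiEtTh2009, Def 3.3 p.73] -/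
theorem divZero_zpow_eq_actionOf (d : (actionOf A ρ).phiZero S) (hd : ∀ s, d.1 s = (constDIV 1 : TateTower.model.DIV))
    (htrans : ∀ s u : S.V, ∃ g : P, S.ρ g s = u) (s₀ : S.V) (b₀ b : (actionOf A ρ).bZero S) {c₀ k₀ c k : ℤ}
    (hb₀ : (b₀.1 s₀).2 = Multiplicative.ofAdd (c₀, k₀)) (hb : (b.1 s₀).2 = Multiplicative.ofAdd (c, k)) :
    (actionOf A ρ).divZero S b ^ k₀ =
      Algebra.GrothendieckGroup.of d ^ (c * k₀ - c₀ * k) * (actionOf A ρ).divZero S b₀ ^ k := by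
  have hq : ((b ^ k₀ * b₀ ^ (-k) : (actionOf A ρ).bZero S).1 s₀).2 = Multiplicative.ofAdd ((c * k₀ - c₀ * k, 0) : ℤ × ℤ) := by
    have e : ((b ^ k₀ * b₀ ^ (-k) : (actionOf A ρ).bZero S).1 s₀) = (b.1 s₀) ^ k₀ * (b₀.1 s₀) ^ (-k) := by
      rw [Subgroup.coe_mul, SubgroupClass.coe_zpow, SubgroupClass.coe_zpow, Pi.mul_apply, Pi.pow_apply, Pi.pow_apply]
    rw [e]
    change (b.1 s₀).2 ^ k₀ * (b₀.1 s₀).2 ^ (-k) = _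
    rw [hb₀, hb]
    refine Multiplicative.toAdd.injective ?_
    simp only [toAdd_mul, toAdd_zpow, toAdd_ofAdd, Prod.smul_mk, smul_eq_mul, Prod.mk_add_mk, Prod.mk.injEq]
    constructor <;> ring
  have h1 := divZero_eq_zpow_of_forall_snd_eq ρ S d hd (b ^ k₀ * b₀ ^ (-k)) _ (snd_apply_eq_of_snd_apply_eq ρ S htrans s₀ _ hq)
  rw [← LogDivisorModel.GaloisAction.divZeroHom_apply, map_mul, map_zpow, map_zpow, LogDivisorModel.GaloisAction.divZeroHom_apply,
    LogDivisorModel.GaloisAction.divZeroHom_apply, zpow_neg] at h1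
  exact mul_inv_eq_iff_eq_mul.mp h1

end LogDivisorModel.TateTowerTwist

/-! ## §B The ζ-twisted Kummer–Tate tower -/

namespace TateTowerKummerTwist

open LogDivisorModel.TateTowerTwist TateTowerFrd RealifiedDivisorMonoids

/-- `z • x = x^z` for `z ∈ ℤ` in the `ℝ`-vector space of a realification datum (abc-iut-L2-d2's private lemma, re-proved).
[cite: MochizukiFrdI2008, Def. 2.4(i) p.48] -/
private theorem rsmul_intCast {D : Type*} [Category D] {Φ : Dᵒᵖ ⥤ CommMonCat} (R : RealificationData Φ) (X : D) (z : ℤ)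
    (x : Algebra.GrothendieckGroup (R.rlf.obj (op X))) : R.rsmul X (z : ℝ) x = x ^ z := by
  cases z with
  | ofNat n => rw [Int.ofNat_eq_natCast, Int.cast_natCast, R.rsmul_natCast, zpow_natCast]
  | negSucc n => rw [Int.cast_negSucc, RealificationDataLemmas.rsmul_neg', R.rsmul_natCast, zpow_negSucc]

/-- `ι : Φ₀(Y)^gp → (Φ₀(Y)^rlf)^gp` of THE weak realification data of `ofTower towerC` on a class `[φ]`.
[cite: MochizukiFrdI2008, Prop. 5.3 p.103] -/
theorem realDataWeak_toRlfGp_of (Y : ConnectedPart (BTemp Compat)) (φ : (towerC.act (levelsC.lvl Y)).phiZero (gset Y)) :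
    (realDataWeak (DivisorMonoids.ofTower towerC) hpfC).toRlfGp Y
        (Algebra.GrothendieckGroup.of (φ : (DivisorMonoids.ofTower towerC).Φ₀.obj (op Y))) =
      Algebra.GrothendieckGroup.of ((hpfC (op Y)).weak.toRealification (Perfection.of _ φ)) :=
  MonGp.map_of _ _

/-- **The multiplicity at `F_j`, read at a base point `s₀`, extends to an `ℝ_{≥0}`-valued degree on `Φ₀(Y)^rlf`** (weak universal
property of the realification; `ℝ` supports `ℝ_{≥0}`). [cite: MochizukiFrdI2008, Prop. 5.3 p.103] -/
theorem exists_rlfHom_val_eq (Y : ConnectedPart (BTemp Compat)) (s₀ : (gset Y).V) (j : ℤ) :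
    ∃ κ : ((realDataWeak (DivisorMonoids.ofTower towerC) hpfC).rlf.obj (op Y)) →* Multiplicative ℝ≥0,
      ∀ φ : (towerC.act (levelsC.lvl Y)).phiZero (gset Y),
        ((Multiplicative.toAdd (κ ((hpfC (op Y)).weak.toRealification (Perfection.of _ φ))) : ℝ≥0) : ℝ) =
          (val (φ.1 s₀) (Sum.inr j) : ℝ) := by
  have hnn : ∀ φ : (towerC.act (levelsC.lvl Y)).phiZero (gset Y), 0 ≤ val (φ.1 s₀) (Sum.inr j) := fun φ =>
    (Submonoid.mem_inf.mp (φ.2.1 s₀)).2 (Sum.inr j)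
  let χ : (towerC.act (levelsC.lvl Y)).phiZero (gset Y) →* Multiplicative ℝ≥0 :=
    { toFun := fun φ => Multiplicative.ofAdd (Real.toNNReal (val (φ.1 s₀) (Sum.inr j) : ℝ))
      map_one' := by
        have h0 : val ((1 : (towerC.act (levelsC.lvl Y)).phiZero (gset Y)).1 s₀) (Sum.inr j) = 0 := rfl
        rw [h0, Int.cast_zero, Real.toNNReal_zero]
        rfl
      map_mul' := fun φ ψ => by
        have hm : val ((φ * ψ).1 s₀) (Sum.inr j) = val (φ.1 s₀) (Sum.inr j) + val (ψ.1 s₀) (Sum.inr j) := rfl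
        rw [← ofAdd_add, hm, Int.cast_add, Real.toNNReal_add (Int.cast_nonneg (hnn φ)) (Int.cast_nonneg (hnn ψ))] }
  have hχ : ∀ φ, ((Multiplicative.toAdd (χ φ) : ℝ≥0) : ℝ) = (val (φ.1 s₀) (Sum.inr j) : ℝ) := fun φ =>
    Real.coe_toNNReal _ (Int.cast_nonneg (hnn φ))
  obtain ⟨κ, hκ, -⟩ := RlfUniversalWeak.existsUnique_lift (hpfC (op Y)).weak (hpfC (op Y)).rlfCofinal
    ArchFrd.Thm36Sub.supports_R_nnreal
    (isPerfect_multiplicative_nnreal.equivPerfection.symm.toMonoidHom.comp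
      (Literature.AlgebraicGeometry.Frobenioids.Perfection.map χ))
  refine ⟨κ, fun φ => ?_⟩
  have h1 : κ ((hpfC (op Y)).weak.toRealification (Perfection.of _ φ)) = χ φ :=
    (DFunLike.congr_fun hκ (Perfection.of _ φ)).trans (DFunLike.congr_fun (IsPerfFactorial.perfectionExtend_spec χ) φ)
  exact (congrArg (fun y : Multiplicative ℝ≥0 => ((Multiplicative.toAdd y : ℝ≥0) : ℝ)) h1).trans (hχ φ)

/-- A degree `κ` on `Φ₀(Y)^rlf`, groupified, on the class of `t ∈ Φ₀(Y)^rlf`: `κ(t)`. [cite: MochizukiFrdI2008, Def. 2.4(i) p.48] -/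
theorem toAdd_lift_of_rlf (Y : ConnectedPart (BTemp Compat))
    (κ : ((realDataWeak (DivisorMonoids.ofTower towerC) hpfC).rlf.obj (op Y)) →* Multiplicative ℝ≥0)
    (t : (hpfC (op Y)).weak.Rlf) :
    Multiplicative.toAdd (Algebra.GrothendieckGroup.lift (PrimeCoord.toRealMul.comp κ)
        (Algebra.GrothendieckGroup.of (M := (hpfC (op Y)).weak.Rlf) t)) =
      ((Multiplicative.toAdd (κ t) : ℝ≥0) : ℝ) :=
  RlfDegreeWeak.toAdd_lift_of κ t

-- heartbeats (justified): the SAME proof text as p465055 (`Sec3EffRealSpanTateTowerKummer`, default budget there) over the LEVEL-DEPENDENT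
-- twisted tower, whose group `Compat ≤ (K ⋊ C) × ℤ_γ` is a reducible tower of abbreviations; every `rw` through `realDataWeak (ofTower towerC) hpfC`
-- costs several times the untwisted one and the sum exceeds 200000 (measured: < 800000; whole file ≈ 20 s on the farm).
set_option maxHeartbeats 800000 in
/-- **The degree "multiplicity at `F_j`" on `ι(div₀ b)` reads `c + k·j`** for `b(s₀) = (ζ, ϖ^c U^k)`. [cite: MochizukiEtTh2009, Def 3.3 p.73] -/
theorem toAdd_lift_toRlfGp_divZero (Y : ConnectedPart (BTemp Compat)) (s₀ : (gset Y).V) (j : ℤ)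
    (κ : ((realDataWeak (DivisorMonoids.ofTower towerC) hpfC).rlf.obj (op Y)) →* Multiplicative ℝ≥0)
    (hκ : ∀ φ : (towerC.act (levelsC.lvl Y)).phiZero (gset Y),
      ((Multiplicative.toAdd (κ ((hpfC (op Y)).weak.toRealification (Perfection.of _ φ))) : ℝ≥0) : ℝ) =
        (val (φ.1 s₀) (Sum.inr j) : ℝ))
    (b : (towerC.act (levelsC.lvl Y)).bZero (gset Y)) :
    Multiplicative.toAdd (Algebra.GrothendieckGroup.lift (PrimeCoord.toRealMul.comp κ)
        ((realDataWeak (DivisorMonoids.ofTower towerC) hpfC).toRlfGp Y ((towerC.act (levelsC.lvl Y)).divZero (gset Y) b))) =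
      ((Multiplicative.toAdd (b.1 s₀).2).1 : ℝ) + (Multiplicative.toAdd (b.1 s₀).2).2 * j := by
  let ι : Algebra.GrothendieckGroup ↥((towerC.act (levelsC.lvl Y)).phiZero (gset Y)) →*
      Algebra.GrothendieckGroup ((realDataWeak (DivisorMonoids.ofTower towerC) hpfC).rlf.obj (op Y)) :=
    (realDataWeak (DivisorMonoids.ofTower towerC) hpfC).toRlfGp Y
  have hι : ∀ φ : (towerC.act (levelsC.lvl Y)).phiZero (gset Y), ι (Algebra.GrothendieckGroup.of φ) =
      Algebra.GrothendieckGroup.of ((hpfC (op Y)).weak.toRealification (Perfection.of _ φ)) := fun φ =>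
    realDataWeak_toRlfGp_of Y φ
  have hN := hκ ((towerC.act (levelsC.lvl Y)).divNum (gset Y) b)
  have hD := hκ ((towerC.act (levelsC.lvl Y)).divDen (gset Y) b)
  have hrel0 : (Multiplicative.toAdd (b.1 s₀).2).1 + (Multiplicative.toAdd (b.1 s₀).2).2 * j +
      val (((towerC.act (levelsC.lvl Y)).divDen (gset Y) b).1 s₀) (Sum.inr j) = val (((towerC.act (levelsC.lvl Y)).divNum (gset Y) b).1 s₀) (Sum.inr j) :=
    val_divNum_inr_actionOf ((rho (levelsC.lvl Y)).comp compat.subtype) (gset Y) b s₀ j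
  have hrel := congrArg (fun z : ℤ => (z : ℝ)) hrel0
  simp only [Int.cast_add, Int.cast_mul] at hrel
  change Multiplicative.toAdd (Algebra.GrothendieckGroup.lift (PrimeCoord.toRealMul.comp κ)
    (ι (Algebra.GrothendieckGroup.of ((towerC.act (levelsC.lvl Y)).divNum (gset Y) b) /
      Algebra.GrothendieckGroup.of ((towerC.act (levelsC.lvl Y)).divDen (gset Y) b)))) = _
  rw [map_div, map_div, toAdd_div, hι, hι, toAdd_lift_of_rlf, toAdd_lift_of_rlf, hN, hD]
  linarith

/-- `ℝ`-linearity of the degrees for the scalar action of THE weak realification data of `ofTower towerC`.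
[cite: MochizukiFrdI2008, Def. 2.4(i) p.48] -/
theorem toAdd_lift_rsmul (Y : ConnectedPart (BTemp Compat))
    (κ : ((realDataWeak (DivisorMonoids.ofTower towerC) hpfC).rlf.obj (op Y)) →* Multiplicative ℝ≥0) (r : ℝ)
    (ξ : Algebra.GrothendieckGroup ((realDataWeak (DivisorMonoids.ofTower towerC) hpfC).rlf.obj (op Y))) :
    Multiplicative.toAdd (Algebra.GrothendieckGroup.lift (PrimeCoord.toRealMul.comp κ)
        ((realDataWeak (DivisorMonoids.ofTower towerC) hpfC).rsmul Y r ξ)) =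
      r * Multiplicative.toAdd (Algebra.GrothendieckGroup.lift (PrimeCoord.toRealMul.comp κ) ξ) :=
  RlfDegreeWeak.toAdd_lift_realSMul (hpfC (op Y)).weak κ r ξ

-- heartbeats (justified): the SAME proof text as p465055 (`Sec3EffRealSpanTateTowerKummer`, default budget there) over the LEVEL-DEPENDENT
-- twisted tower, whose group `Compat ≤ (K ⋊ C) × ℤ_γ` is a reducible tower of abbreviations; every `rw` through `realDataWeak (ofTower towerC) hpfC`
-- costs several times the untwisted one and the sum exceeds 200000 (measured: < 800000; whole file ≈ 20 s on the farm).
set_option maxHeartbeats 800000 in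
/-- **Normal form of `ℝ·Φ₀^birat(Y)` at the ζ-twisted tower**: with a base point `s₀` and a reference function `b₀ ∈ B₀(Y)`,
`b₀(s₀) = (·, ϖ^{c₀} U^{k₀})`, such that `k₀ ≠ 0` as soon as some `b ∈ B₀(Y)` has a `U`-part at `s₀`, every element of `ℝ·Φ₀^birat(Y)` is
`a • ι[Σ_j F_j] · β • ι(div₀ b₀)`. [cite: MochizukiFrdI2008, Prop. 5.3 p.103] -/
theorem exists_eq_rsmul_mul_rsmul (Y : ConnectedPart (BTemp Compat)) (s₀ : (gset Y).V) (b₀ : (towerC.act (levelsC.lvl Y)).bZero (gset Y)) {c₀ k₀ : ℤ}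
    (hb₀ : (b₀.1 s₀).2 = Multiplicative.ofAdd (c₀, k₀))
    (H : ∀ b : (towerC.act (levelsC.lvl Y)).bZero (gset Y), (Multiplicative.toAdd (b.1 s₀).2).2 ≠ 0 → k₀ ≠ 0)
    {ξ : Algebra.GrothendieckGroup ((realDataWeak (DivisorMonoids.ofTower towerC) hpfC).rlf.obj (op Y))}
    (hξ : ξ ∈ ((realDataWeak (DivisorMonoids.ofTower towerC) hpfC).realSpan (DivisorMonoids.ofTower towerC).biratGp).carrier Y) :
    ∃ a β : ℝ, ξ =
      (realDataWeak (DivisorMonoids.ofTower towerC) hpfC).rsmul Y a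
          ((realDataWeak (DivisorMonoids.ofTower towerC) hpfC).toRlfGp Y (Algebra.GrothendieckGroup.of
            ((⟨_, constDIV_one_mem_phiZero_actionOf ((rho (levelsC.lvl Y)).comp compat.subtype) (gset Y)⟩ : (towerC.act (levelsC.lvl Y)).phiZero (gset Y)) :
              (DivisorMonoids.ofTower towerC).Φ₀.obj (op Y)))) *
        (realDataWeak (DivisorMonoids.ofTower towerC) hpfC).rsmul Y β
          ((realDataWeak (DivisorMonoids.ofTower towerC) hpfC).toRlfGp Y ((towerC.act (levelsC.lvl Y)).divZero (gset Y) b₀)) := by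
  have htrans := ((BTemp.isConnectedObj_iff Y.obj).mp Y.property).2
  let R := realDataWeak (DivisorMonoids.ofTower towerC) hpfC
  let ι : Algebra.GrothendieckGroup ↥((towerC.act (levelsC.lvl Y)).phiZero (gset Y)) →* Algebra.GrothendieckGroup (R.rlf.obj (op Y)) := R.toRlfGp Y
  let d : (towerC.act (levelsC.lvl Y)).phiZero (gset Y) := ⟨_, constDIV_one_mem_phiZero_actionOf ((rho (levelsC.lvl Y)).comp compat.subtype) (gset Y)⟩
  let G₁ := ι (Algebra.GrothendieckGroup.of d)
  let g₀ := ι ((towerC.act (levelsC.lvl Y)).divZero (gset Y) b₀)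
  let P : Algebra.GrothendieckGroup (R.rlf.obj (op Y)) → Prop := fun x => ∃ a β : ℝ, x = R.rsmul Y a G₁ * R.rsmul Y β g₀
  have P1 : P 1 := ⟨0, 0, by rw [R.rsmul_zero, R.rsmul_zero, mul_one]⟩
  have Pmul : ∀ x y, P x → P y → P (x * y) := by
    rintro x y ⟨a, β, rfl⟩ ⟨a', β', rfl⟩
    exact ⟨a + a', β + β', by rw [R.rsmul_add, R.rsmul_add, mul_mul_mul_comm]⟩
  have Pinv : ∀ x, P x → P x⁻¹ := by
    rintro x ⟨a, β, rfl⟩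
    exact ⟨-a, -β, by rw [RealificationDataLemmas.rsmul_neg', RealificationDataLemmas.rsmul_neg', mul_inv]⟩
  have Psmul : ∀ (r : ℝ) x, P x → P (R.rsmul Y r x) := by
    rintro r x ⟨a, β, rfl⟩
    exact ⟨r * a, r * β, by rw [map_mul, R.rsmul_mul, R.rsmul_mul]⟩
  have hd : ∀ s, d.1 s = (constDIV 1 : TateTower.model.DIV) := fun _ => rfl
  have Pgen : ∀ b : (towerC.act (levelsC.lvl Y)).bZero (gset Y), P (ι ((towerC.act (levelsC.lvl Y)).divZero (gset Y) b)) := by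
    intro b
    by_cases hk : (Multiplicative.toAdd (b.1 s₀).2).2 = 0
    · have hc0 : (b.1 s₀).2 = Multiplicative.ofAdd (((Multiplicative.toAdd (b.1 s₀).2).1, 0) : ℤ × ℤ) :=
        Multiplicative.toAdd.injective (Prod.ext rfl hk)
      have hc := snd_apply_eq_of_snd_apply_eq ((rho (levelsC.lvl Y)).comp compat.subtype) (gset Y) htrans s₀ b hc0
      have hdiv : (towerC.act (levelsC.lvl Y)).divZero (gset Y) b = Algebra.GrothendieckGroup.of d ^ (Multiplicative.toAdd (b.1 s₀).2).1 :=
        divZero_eq_zpow_of_forall_snd_eq ((rho (levelsC.lvl Y)).comp compat.subtype) (gset Y) d hd b _ hc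
      refine ⟨(Multiplicative.toAdd (b.1 s₀).2).1, 0, ?_⟩
      rw [hdiv, map_zpow, R.rsmul_zero, mul_one, rsmul_intCast]
    · have hk₀ : k₀ ≠ 0 := H b hk
      have hpow : (towerC.act (levelsC.lvl Y)).divZero (gset Y) b ^ k₀ =
          Algebra.GrothendieckGroup.of d ^ ((Multiplicative.toAdd (b.1 s₀).2).1 * k₀ - c₀ * (Multiplicative.toAdd (b.1 s₀).2).2) *
            (towerC.act (levelsC.lvl Y)).divZero (gset Y) b₀ ^ (Multiplicative.toAdd (b.1 s₀).2).2 :=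
        divZero_zpow_eq_actionOf ((rho (levelsC.lvl Y)).comp compat.subtype) (gset Y) d hd htrans s₀ b₀ b hb₀
          (rfl : (b.1 s₀).2 = Multiplicative.ofAdd ((Multiplicative.toAdd (b.1 s₀).2).1, (Multiplicative.toAdd (b.1 s₀).2).2))
      have h2 := congrArg ι hpow
      rw [map_zpow, map_mul, map_zpow, map_zpow] at h2
      exact ⟨_, _, RealificationDataLemmas.eq_rsmul_mul_rsmul_of_zpow_eq R Y hk₀ h2⟩
  have Pbirat : ∀ c ∈ (DivisorMonoids.ofTower towerC).biratGp.carrier Y, P (R.toRlfGp Y c) := by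
    intro c hc
    induction hc using Subgroup.closure_induction with
    | mem y hy =>
      obtain ⟨b, rfl⟩ := hy
      exact Pgen b
    | one => rw [map_one]; exact P1
    | mul y z _ _ hy hz => rw [map_mul]; exact Pmul _ _ hy hz
    | inv y _ hy => rw [map_inv]; exact Pinv _ hy
  have key : ∀ x ∈ (R.realSpan (DivisorMonoids.ofTower towerC).biratGp).carrier Y, P x := by
    intro x hx
    induction hx using Subgroup.closure_induction with
    | mem y hy =>
      obtain ⟨r, c, hc, rfl⟩ := hy
      exact Psmul r _ (Pbirat c hc)
    | one => exact P1
    | mul y z _ _ hy hz => exact Pmul _ _ hy hz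
    | inv y _ hy => exact Pinv _ hy
  exact key ξ hξ

/-- If `A + B j ≥ 0` for every integer `j`, then `B = 0`. [folklore] -/
private theorem eq_zero_of_forall_int_nonneg {A B : ℝ} (h : ∀ j : ℤ, 0 ≤ A + B * j) : B = 0 := by
  by_contra hB
  rcases lt_or_gt_of_ne hB with hB' | hB'
  · obtain ⟨j, hj⟩ := exists_int_gt (-A / B)
    have h1 : B * (j : ℝ) < B * (-A / B) := mul_lt_mul_of_neg_left hj hB'
    have h3 := h j
    rw [mul_div_cancel₀ (-A) hB] at h1
    linarith
  · obtain ⟨j, hj⟩ := exists_int_lt (-A / B)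
    have h1 : B * (j : ℝ) < B * (-A / B) := mul_lt_mul_of_pos_left hj hB'
    have h3 := h j
    rw [mul_div_cancel₀ (-A) hB] at h1
    linarith

-- heartbeats (justified): the SAME proof text as p465055 (`Sec3EffRealSpanTateTowerKummer`, default budget there) over the LEVEL-DEPENDENT
-- twisted tower, whose group `Compat ≤ (K ⋊ C) × ℤ_γ` is a reducible tower of abbreviations; every `rw` through `realDataWeak (ofTower towerC) hpfC`
-- costs several times the untwisted one and the sum exceeds 200000 (measured: < 800000; whole file ≈ 20 s on the farm).
set_option maxHeartbeats 800000 in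
/-- **The `Λ = ℝ` effective-locus clause `hE` of [EtTh] Prop. 3.4 (ii) (census A2) HOLDS at the ζ-TWISTED Kummer–Tate tower**: at every
connected tempered covering `Y : B^temp(Compat)⁰`, read at the level of its `Δ^fil`-closure (`DivisorMonoids.ofTower towerC`), an element of
`ℝ·Φ₀^birat(Y)` which is the class of an element of `Φ₀(Y)^rlf` lies in `ℝ·Φ₀^cnst(Y)`. [cite: MochizukiEtTh2009, Prop 3.4 (ii) p.74] -/
theorem effRealSpan_ofTowerC (Y : ConnectedPart (BTemp Compat))
    (b : Algebra.GrothendieckGroup ((realDataWeak (DivisorMonoids.ofTower towerC) hpfC).rlf.obj (op Y)))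
    (x : (hpfC (op Y)).weak.Rlf)
    (hb : b ∈ ((realDataWeak (DivisorMonoids.ofTower towerC) hpfC).realSpan (DivisorMonoids.ofTower towerC).biratGp).carrier Y)
    (hbx : b = Algebra.GrothendieckGroup.of x) :
    b ∈ ((realDataWeak (DivisorMonoids.ofTower towerC) hpfC).realSpan (DivisorMonoids.ofTower towerC).cnstGp).carrier Y := by
  classical
  obtain ⟨⟨s₀⟩, htrans⟩ := (BTemp.isConnectedObj_iff Y.obj).mp Y.property
  have hG₁ : Algebra.GrothendieckGroup.of ((⟨_, constDIV_one_mem_phiZero_actionOf ((rho (levelsC.lvl Y)).comp compat.subtype) (gset Y)⟩ :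
      (towerC.act (levelsC.lvl Y)).phiZero (gset Y)) : (DivisorMonoids.ofTower towerC).Φ₀.obj (op Y)) ∈
        (DivisorMonoids.ofTower towerC).cnstGp.carrier Y := by
    refine (DivisorMonoids.ofTower towerC).mem_cnstGp_of_mem_cnst Y
      ⟨⟨_, unif_mem_bZero_actionOf ((rho (levelsC.lvl Y)).comp compat.subtype) (gset Y)⟩, fun _ => unif_mem_const (MuN (levelsC.lvl Y)), ?_⟩
    have h : (towerC.act (levelsC.lvl Y)).divZero (gset Y) ⟨_, unif_mem_bZero_actionOf ((rho (levelsC.lvl Y)).comp compat.subtype) (gset Y)⟩ =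
        Algebra.GrothendieckGroup.of ((⟨_, constDIV_one_mem_phiZero_actionOf ((rho (levelsC.lvl Y)).comp compat.subtype) (gset Y)⟩ :
          (towerC.act (levelsC.lvl Y)).phiZero (gset Y))) ^ (1 : ℤ) :=
      divZero_eq_zpow_of_forall_snd_eq ((rho (levelsC.lvl Y)).comp compat.subtype) (gset Y) _ (fun _ => rfl) _ 1 (fun _ => rfl)
    rw [zpow_one] at h
    exact h
  by_cases hU : ∃ b' : (towerC.act (levelsC.lvl Y)).bZero (gset Y), (Multiplicative.toAdd (b'.1 s₀).2).2 ≠ 0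
  · obtain ⟨b₀, hk₀⟩ := hU
    obtain ⟨a, β, hξ⟩ := exists_eq_rsmul_mul_rsmul Y s₀ b₀ (c₀ := (Multiplicative.toAdd (b₀.1 s₀).2).1)
      (k₀ := (Multiplicative.toAdd (b₀.1 s₀).2).2) rfl (fun _ _ => hk₀) hb
    have hβ : β * (Multiplicative.toAdd (b₀.1 s₀).2).2 = 0 := by
      refine eq_zero_of_forall_int_nonneg (A := a + β * (Multiplicative.toAdd (b₀.1 s₀).2).1) fun j => ?_
      obtain ⟨κ, hκ⟩ := exists_rlfHom_val_eq Y s₀ j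
      have h0 : 0 ≤ Multiplicative.toAdd (Algebra.GrothendieckGroup.lift (PrimeCoord.toRealMul.comp κ) b) := by
        rw [hbx]
        exact RlfDegreeWeak.toAdd_lift_of_nonneg κ x
      have h1 : ((Multiplicative.toAdd (κ ((hpfC (op Y)).weak.toRealification (Perfection.of _
          ((⟨_, constDIV_one_mem_phiZero_actionOf ((rho (levelsC.lvl Y)).comp compat.subtype) (gset Y)⟩ :
            (towerC.act (levelsC.lvl Y)).phiZero (gset Y)))))) : ℝ≥0) : ℝ) = 1 := by
        rw [hκ]
        exact Int.cast_one
      rw [hξ, map_mul, toAdd_mul, toAdd_lift_rsmul, toAdd_lift_rsmul, toAdd_lift_toRlfGp_divZero Y s₀ j κ hκ b₀,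
        realDataWeak_toRlfGp_of, toAdd_lift_of_rlf, h1] at h0
      linarith
    have hβ0 : β = 0 := (mul_eq_zero.mp hβ).resolve_right (Int.cast_ne_zero.mpr hk₀)
    rw [hξ, hβ0, (realDataWeak (DivisorMonoids.ofTower towerC) hpfC).rsmul_zero, mul_one]
    exact Subgroup.subset_closure ⟨a, _, hG₁, rfl⟩
  · obtain ⟨a, β, hξ⟩ :=
      exists_eq_rsmul_mul_rsmul Y s₀ 1 (c₀ := 0) (k₀ := 0) rfl (fun b' hb' => (hU ⟨b', hb'⟩).elim) hb
    have h1 : (realDataWeak (DivisorMonoids.ofTower towerC) hpfC).toRlfGp Y ((towerC.act (levelsC.lvl Y)).divZero (gset Y) 1) = 1 := by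
      have h := map_one ((towerC.act (levelsC.lvl Y)).divZeroHom (gset Y))
      rw [LogDivisorModel.GaloisAction.divZeroHom_apply] at h
      rw [h]
      exact map_one ((realDataWeak (DivisorMonoids.ofTower towerC) hpfC).toRlfGp Y)
    rw [hξ, h1, map_one, mul_one]
    exact Subgroup.subset_closure ⟨a, _, hG₁, rfl⟩

end TateTowerKummerTwist

end Literature.AnabelianGeometry.EtaleTheta

end
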